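import Mathlib.Analysis.SpecialFunctions.SmoothTransition
import Mathlib.Analysis.SpecialFunctions.Sqrt
import Mathlib.Analysis.SpecialFunctions.Pow.Deriv
import Mathlib.Analysis.Calculus.Deriv.Inv
import Mathlib.Analysis.Calculus.IteratedDeriv.Lemmas
import Mathlib.Analysis.Normed.Group.Bounded

/-!
# Smooth one-variable profiles for the vortex-filament test kernel

Support file for the proof of the Jerrard–Seis energy lower bound
(`Literature.Analysis.FluidPDE.VortexFilament.JerrardSeis2016_filamentEnergyLowerBound`).
The proof tests the flat-norm hypothesis against the field `ξ = F ∗ μ_Γ` where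
`F(z) = ε⁻¹ a(|z|²/ε²) b(|z|²/R²)` is a smoothly capped and cut-off Newtonian kernel `1/|z|`
(cf. the prototype potential `G ∗ ρ^ε ∗ μ_Γ` of [JerrardSeis2016, §2.5, §4.3]). This file
provides the EXISTENCE of the two fixed smooth profiles (no new definitions are introduced; the
witnesses are built from Mathlib's `Real.smoothTransition` `S`):

* `exists_profileA`: a `C²`, antitone `a : ℝ → ℝ` with `0 < a ≤ √2`, `a(s²) = 1/s` for `s ≥ 1`,
  the closed forms `a'(s²) = −1/(2s³)`, `a''(s²) = 3/(4s⁵)` for `s > 1`, and uniform bounds for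
  `|a'|`, `|a''|` on `[0, 1]`; witness `a τ = (√m(τ))⁻¹`, `m τ = ½ + (τ − ½) S(2τ − 1)`.
* `exists_profileB`: a `C²`, antitone cutoff `b : ℝ → ℝ` with values in `[0, 1]`, `= 1` on
  `(−∞, ¼]`, `= 0` on `[1, ∞)`, `b' = b'' = 0` off `[¼, 1]`, and global bounds for `|b'|`,
  `|b''|`; witness `b τ = 1 − S((4τ − 1)/3)`.

Because the profiles are fixed, every constant in the energy estimate is absolute (the kernel at
scales `ε`, `R` is obtained by rescaling). [folklore]
-/

noncomputable section

open Set Filter Real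
open scoped Topology

namespace Literature.Analysis.FluidPDE

namespace VortexFilament

/-- [folklore] -/
theorem continuous_deriv2_of_contDiff_two {f : ℝ → ℝ} (hf : ContDiff ℝ 2 f) :
    Continuous (deriv (deriv f)) := by
  have h2 : ContDiff ℝ ((1 : WithTop ℕ∞) + 1) f := by simpa [one_add_one_eq_two] using hf
  have h1 : ContDiff ℝ 1 (deriv f) := (contDiff_succ_iff_deriv.1 h2).2.2
  have h : ContDiff ℝ ((0 : WithTop ℕ∞) + 1) (deriv f) := by simpa using h1
  exact ((contDiff_succ_iff_deriv.1 h).2.2).continuous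

/-- The first derivative of a `C²` function is continuous. [folklore] -/
theorem continuous_deriv_of_contDiff_two {f : ℝ → ℝ} (hf : ContDiff ℝ 2 f) :
    Continuous (deriv f) :=
  hf.continuous_deriv (by simp)

/-- [folklore] -/
theorem hasDerivAt_of_contDiff_two {f : ℝ → ℝ} (hf : ContDiff ℝ 2 f) (τ : ℝ) :
    HasDerivAt f (deriv f τ) τ :=
  (hf.differentiable (by simp) τ).hasDerivAt

/-- [folklore] -/
theorem hasDerivAt_deriv_of_contDiff_two {f : ℝ → ℝ} (hf : ContDiff ℝ 2 f) (τ : ℝ) :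
    HasDerivAt (deriv f) (deriv (deriv f) τ) τ := by
  have h2 : ContDiff ℝ ((1 : WithTop ℕ∞) + 1) f := by simpa [one_add_one_eq_two] using hf
  have h1 : ContDiff ℝ 1 (deriv f) := (contDiff_succ_iff_deriv.1 h2).2.2
  exact (h1.differentiable (by simp) τ).hasDerivAt

/-- If `f` is locally constant near `τ` then `f' τ = 0` and, if moreover this holds on an open
set, `f'' = 0` there. Off-support vanishing of derivatives. [folklore] -/
theorem deriv_eq_zero_of_eventuallyEq_const {f : ℝ → ℝ} {τ c : ℝ} (h : f =ᶠ[𝓝 τ] fun _ => c) :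
    deriv f τ = 0 := by
  rw [h.deriv_eq, deriv_const]

/-- **Profile `a`.** There is a `C²`, antitone function `a : ℝ → ℝ` with `0 < a ≤ √2`,
`a(s²) = 1/s` (`s ≥ 1`), `a'(s²) = −1/(2s³)` and `a''(s²) = 3/(4s⁵)` (`s > 1`), and with `|a'|`,
`|a''|` bounded on `[0,1]`. Witness: `a = (√m)⁻¹`, `m τ = ½ + (τ − ½) S(2τ − 1)` with
`S = Real.smoothTransition`. [folklore] -/
theorem exists_profileA : ∃ a : ℝ → ℝ, ContDiff ℝ 2 a ∧ Antitone a ∧ (∀ τ, 0 < a τ) ∧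
    (∀ τ, a τ ≤ Real.sqrt 2) ∧ (∀ s : ℝ, 1 ≤ s → a (s ^ 2) = s⁻¹) ∧
    (∀ s : ℝ, 1 < s → deriv a (s ^ 2) = -1 / (2 * s ^ 3)) ∧
    (∀ s : ℝ, 1 < s → deriv (deriv a) (s ^ 2) = 3 / (4 * s ^ 5)) ∧
    (∃ A₁ : ℝ, 0 ≤ A₁ ∧ ∀ τ ∈ Icc (0:ℝ) 1, |deriv a τ| ≤ A₁) ∧
    (∃ A₂ : ℝ, 0 ≤ A₂ ∧ ∀ τ ∈ Icc (0:ℝ) 1, |deriv (deriv a) τ| ≤ A₂) := by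
  set m : ℝ → ℝ := fun τ => 1 / 2 + (τ - 1 / 2) * smoothTransition (2 * τ - 1) with hm
  set a : ℝ → ℝ := fun τ => (Real.sqrt (m τ))⁻¹ with ha
  -- properties of `m`
  have m_of_one_le : ∀ {τ : ℝ}, 1 ≤ τ → m τ = τ := fun {τ} h => by
    simp only [hm]; rw [smoothTransition.one_of_one_le (by linarith)]; ring
  have m_of_le_half : ∀ {τ : ℝ}, τ ≤ 1 / 2 → m τ = 1 / 2 := fun {τ} h => by
    simp only [hm]; rw [smoothTransition.zero_of_nonpos (by linarith)]; ring
  have half_le_m : ∀ τ, 1 / 2 ≤ m τ := fun τ => by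
    simp only [hm]
    rcases le_or_gt τ (1 / 2) with h | h
    · rw [smoothTransition.zero_of_nonpos (by linarith)]; linarith
    · have := smoothTransition.nonneg (2 * τ - 1)
      nlinarith
  have m_pos : ∀ τ, 0 < m τ := fun τ => lt_of_lt_of_le (by norm_num) (half_le_m τ)
  have m_mono : Monotone m := by
    intro x y hxy
    rcases le_or_gt y (1 / 2) with hy | hy
    · rw [m_of_le_half hy, m_of_le_half (hxy.trans hy)]
    rcases le_or_gt x (1 / 2) with hx | hx
    · rw [m_of_le_half hx]; exact half_le_m y
    · simp only [hm]
      have h1 : smoothTransition (2 * x - 1) ≤ smoothTransition (2 * y - 1) :=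
        smoothTransition.monotone (by linarith)
      nlinarith [mul_le_mul_of_nonneg_left h1 (by linarith : (0:ℝ) ≤ x - 1 / 2),
        mul_le_mul_of_nonneg_right (by linarith : x - 1 / 2 ≤ y - 1 / 2)
          (smoothTransition.nonneg (2 * y - 1))]
  have m_smooth : ContDiff ℝ 2 m := by
    simp only [hm]
    refine contDiff_const.add ((contDiff_id.sub contDiff_const).mul ?_)
    exact smoothTransition.contDiff.comp ((contDiff_const.mul contDiff_id).sub contDiff_const)
  -- properties of `a`
  have a_smooth : ContDiff ℝ 2 a := by
    rw [contDiff_iff_contDiffAt]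
    intro τ
    have h1 : ContDiffAt ℝ 2 (fun τ => Real.sqrt (m τ)) τ :=
      (Real.contDiffAt_sqrt (m_pos τ).ne').comp τ m_smooth.contDiffAt
    exact h1.inv (Real.sqrt_pos.2 (m_pos τ)).ne'
  have a_of_one_le : ∀ {τ : ℝ}, 1 ≤ τ → a τ = (Real.sqrt τ)⁻¹ := fun {τ} h => by
    simp only [ha]; rw [m_of_one_le h]
  have a_eventuallyEq : ∀ {τ : ℝ}, 1 < τ → a =ᶠ[𝓝 τ] fun σ => (Real.sqrt σ)⁻¹ := fun {τ} h => by
    filter_upwards [Ioi_mem_nhds h] with σ hσ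
    exact a_of_one_le (le_of_lt hσ)
  have a_deriv_sq : ∀ s : ℝ, 1 < s → deriv a (s ^ 2) = -1 / (2 * s ^ 3) := by
    intro s h
    have hs : 0 < s := by linarith
    have h2 : 1 < s ^ 2 := by nlinarith
    rw [(a_eventuallyEq h2).deriv_eq]
    have hd : HasDerivAt (fun σ => (Real.sqrt σ)⁻¹)
        (-(1 / (2 * Real.sqrt (s ^ 2))) / Real.sqrt (s ^ 2) ^ 2) (s ^ 2) :=
      (Real.hasDerivAt_sqrt (x := s ^ 2) (by positivity)).inv
        (by rw [Real.sqrt_sq hs.le]; exact hs.ne')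
    rw [hd.deriv, Real.sqrt_sq hs.le]
    field_simp
  have a_deriv_of_one_lt : ∀ {σ : ℝ}, 1 < σ → deriv a σ = -1 / (2 * σ * Real.sqrt σ) := by
    intro σ h
    have hσ : 0 < σ := by linarith
    have hs : 1 < Real.sqrt σ := by
      rw [show (1:ℝ) = Real.sqrt 1 by simp]
      exact Real.sqrt_lt_sqrt (by norm_num) h
    have := a_deriv_sq _ hs
    rw [Real.sq_sqrt hσ.le] at this
    rw [this, show Real.sqrt σ ^ 3 = σ * Real.sqrt σ by rw [pow_succ, Real.sq_sqrt hσ.le]]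
    ring
  have a_deriv2_sq : ∀ s : ℝ, 1 < s → deriv (deriv a) (s ^ 2) = 3 / (4 * s ^ 5) := by
    intro s h
    have hs : 0 < s := by linarith
    have h2 : 1 < s ^ 2 := by nlinarith
    have hev : deriv a =ᶠ[𝓝 (s ^ 2)] fun σ => -1 / (2 * σ * Real.sqrt σ) := by
      filter_upwards [Ioi_mem_nhds h2] with σ hσ
      exact a_deriv_of_one_lt hσ
    rw [hev.deriv_eq]
    have h1 : HasDerivAt (fun σ => 2 * σ * Real.sqrt σ)
        (2 * 1 * Real.sqrt (s ^ 2) + 2 * s ^ 2 * (1 / (2 * Real.sqrt (s ^ 2)))) (s ^ 2) :=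
      ((hasDerivAt_id' (s ^ 2)).const_mul (2:ℝ)).mul (Real.hasDerivAt_sqrt (by positivity))
    have hne : 2 * s ^ 2 * Real.sqrt (s ^ 2) ≠ 0 := by rw [Real.sqrt_sq hs.le]; positivity
    have h3 : HasDerivAt (fun σ => -(2 * σ * Real.sqrt σ)⁻¹)
        (-(-(2 * 1 * Real.sqrt (s ^ 2) + 2 * s ^ 2 * (1 / (2 * Real.sqrt (s ^ 2)))) /
          (2 * s ^ 2 * Real.sqrt (s ^ 2)) ^ 2)) (s ^ 2) := (h1.inv hne).neg
    have h4 : (fun σ => -1 / (2 * σ * Real.sqrt σ)) = fun σ => -(2 * σ * Real.sqrt σ)⁻¹ := by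
      funext σ; rw [neg_div, one_div]
    rw [h4, h3.deriv, Real.sqrt_sq hs.le]
    field_simp
    ring
  refine ⟨a, a_smooth, ?_, ?_, ?_, ?_, a_deriv_sq, a_deriv2_sq, ?_, ?_⟩
  · -- antitone
    intro x y hxy
    simp only [ha]
    exact inv_anti₀ (Real.sqrt_pos.2 (m_pos x)) (Real.sqrt_le_sqrt (m_mono hxy))
  · exact fun τ => inv_pos.2 (Real.sqrt_pos.2 (m_pos τ))
  · intro τ
    simp only [ha]
    have h : Real.sqrt (1 / 2) ≤ Real.sqrt (m τ) := Real.sqrt_le_sqrt (half_le_m τ)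
    rw [one_div, Real.sqrt_inv] at h
    calc (Real.sqrt (m τ))⁻¹ ≤ ((Real.sqrt 2)⁻¹)⁻¹ := inv_anti₀ (by positivity) h
      _ = Real.sqrt 2 := inv_inv _
  · intro s hs
    rw [a_of_one_le (by nlinarith), Real.sqrt_sq (by linarith)]
  · obtain ⟨C, hC⟩ := isCompact_Icc.exists_bound_of_continuousOn
      ((continuous_deriv_of_contDiff_two a_smooth).continuousOn (s := Icc (0:ℝ) 1))
    refine ⟨max C 0, le_max_right _ _, fun τ hτ => ?_⟩
    exact (le_max_left _ _).trans' (by simpa [Real.norm_eq_abs] using hC τ hτ)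
  · obtain ⟨C, hC⟩ := isCompact_Icc.exists_bound_of_continuousOn
      ((continuous_deriv2_of_contDiff_two a_smooth).continuousOn (s := Icc (0:ℝ) 1))
    refine ⟨max C 0, le_max_right _ _, fun τ hτ => ?_⟩
    exact (le_max_left _ _).trans' (by simpa [Real.norm_eq_abs] using hC τ hτ)

/-- **Profile `b` (cutoff).** There is a `C²`, antitone `b : ℝ → ℝ` with `0 ≤ b ≤ 1`, `b = 1` on
`(−∞, ¼]`, `b = 0` on `[1, ∞)`, `b' = b'' = 0` off `[¼, 1]`, and `|b'|`, `|b''|` bounded.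
Witness: `b τ = 1 − S((4τ − 1)/3)`, `S = Real.smoothTransition`. [folklore] -/
theorem exists_profileB : ∃ b : ℝ → ℝ, ContDiff ℝ 2 b ∧ Antitone b ∧ (∀ τ, 0 ≤ b τ) ∧
    (∀ τ, b τ ≤ 1) ∧ (∀ τ : ℝ, τ ≤ 1 / 4 → b τ = 1) ∧ (∀ τ : ℝ, 1 ≤ τ → b τ = 0) ∧
    (∀ τ : ℝ, τ < 1 / 4 ∨ 1 < τ → deriv b τ = 0) ∧
    (∀ τ : ℝ, τ < 1 / 4 ∨ 1 < τ → deriv (deriv b) τ = 0) ∧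
    (∃ B₁ : ℝ, 0 ≤ B₁ ∧ ∀ τ, |deriv b τ| ≤ B₁) ∧
    (∃ B₂ : ℝ, 0 ≤ B₂ ∧ ∀ τ, |deriv (deriv b) τ| ≤ B₂) := by
  set b : ℝ → ℝ := fun τ => 1 - smoothTransition ((4 * τ - 1) / 3) with hb
  have b_quarter : ∀ τ : ℝ, τ ≤ 1 / 4 → b τ = 1 := fun τ h => by
    simp only [hb]; rw [smoothTransition.zero_of_nonpos (by linarith)]; ring
  have b_one : ∀ τ : ℝ, 1 ≤ τ → b τ = 0 := fun τ h => by
    simp only [hb]; rw [smoothTransition.one_of_one_le (by linarith)]; ring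
  have b_smooth : ContDiff ℝ 2 b := by
    simp only [hb]
    exact contDiff_const.sub (smoothTransition.contDiff.comp
      (((contDiff_const.mul contDiff_id).sub contDiff_const).div_const _))
  have b_deriv_zero : ∀ τ : ℝ, τ < 1 / 4 ∨ 1 < τ → deriv b τ = 0 := by
    intro τ h
    rcases h with h | h
    · apply deriv_eq_zero_of_eventuallyEq_const (c := 1)
      filter_upwards [Iio_mem_nhds h] with σ hσ using b_quarter σ (le_of_lt hσ)
    · apply deriv_eq_zero_of_eventuallyEq_const (c := 0)
      filter_upwards [Ioi_mem_nhds h] with σ hσ using b_one σ (le_of_lt hσ)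
  have b_deriv2_zero : ∀ τ : ℝ, τ < 1 / 4 ∨ 1 < τ → deriv (deriv b) τ = 0 := by
    intro τ h
    rcases h with h | h
    · apply deriv_eq_zero_of_eventuallyEq_const (c := 0)
      filter_upwards [Iio_mem_nhds h] with σ hσ using b_deriv_zero σ (Or.inl hσ)
    · apply deriv_eq_zero_of_eventuallyEq_const (c := 0)
      filter_upwards [Ioi_mem_nhds h] with σ hσ using b_deriv_zero σ (Or.inr hσ)
  have off : ∀ τ : ℝ, τ ∉ Icc (0:ℝ) 2 → τ < 1 / 4 ∨ 1 < τ := by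
    intro τ hτ
    simp only [mem_Icc, not_and_or, not_le] at hτ
    rcases hτ with hτ | hτ
    · left; linarith
    · right; linarith
  refine ⟨b, b_smooth, ?_, ?_, ?_, b_quarter, b_one, b_deriv_zero, b_deriv2_zero, ?_, ?_⟩
  · intro x y hxy
    simp only [hb]
    have := smoothTransition.monotone (show (4 * x - 1) / 3 ≤ (4 * y - 1) / 3 by linarith)
    linarith
  · intro τ; simp only [hb]; linarith [smoothTransition.le_one ((4 * τ - 1) / 3)]
  · intro τ; simp only [hb]; linarith [smoothTransition.nonneg ((4 * τ - 1) / 3)]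
  · obtain ⟨C, hC⟩ := isCompact_Icc.exists_bound_of_continuousOn
      ((continuous_deriv_of_contDiff_two b_smooth).continuousOn (s := Icc (0:ℝ) 2))
    refine ⟨max C 0, le_max_right _ _, fun τ => ?_⟩
    by_cases hτ : τ ∈ Icc (0:ℝ) 2
    · exact (le_max_left _ _).trans' (by simpa [Real.norm_eq_abs] using hC τ hτ)
    · rw [b_deriv_zero τ (off τ hτ), abs_zero]; exact le_max_right _ _
  · obtain ⟨C, hC⟩ := isCompact_Icc.exists_bound_of_continuousOn
      ((continuous_deriv2_of_contDiff_two b_smooth).continuousOn (s := Icc (0:ℝ) 2))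
    refine ⟨max C 0, le_max_right _ _, fun τ => ?_⟩
    by_cases hτ : τ ∈ Icc (0:ℝ) 2
    · exact (le_max_left _ _).trans' (by simpa [Real.norm_eq_abs] using hC τ hτ)
    · rw [b_deriv2_zero τ (off τ hτ), abs_zero]; exact le_max_right _ _

end VortexFilament

end Literature.Analysis.FluidPDE
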